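import Mathlib.AlgebraicGeometry.Morphisms.Flat
import Mathlib.AlgebraicGeometry.Morphisms.Affine
import Mathlib.AlgebraicGeometry.Morphisms.UnderlyingMap
import Mathlib.AlgebraicGeometry.Pullbacks
import Literature.AlgebraicGeometry.Resolution.WeightedResolutionDatum
import Literature.AlgebraicGeometry.Resolution.IdealSheafLemmas
import Literature.AlgebraicGeometry.Resolution.IdealSheafDescent
import Summits.ResolutionOfSingularities.ResolutionOfSingularities.Theorems.WeightedInvariantWeightedConstructionOffExceptional

/-!
# Cobordant blow-ups of affine charts commute with extension of the ground field

Route `ResolutionOfSingularities/WeightedInvariant`, crux `WeightedConstruction`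
(stmt-ResolutionOfSingularities-0571), line `support-first-weights-second`, stub
`stub_cobordantPlus_baseChange` (stub R3b of the lead skeleton; CONDITIONAL on the ring statement
`H` = stub R3a `stub_extReesAlgebra_baseChange` — the extended Rees algebra commutes with flat base
change, with the universal property of the pushout —, taken as a hypothesis).

What is proved. For a cartesian square `pr : YK = Y ×_{Spec k} Spec K → Y` over a homomorphism of
fields `φ : k → K`, Rees algebras `R` on `Y` and `RK` on `YK` with `RKₙ = pr⁻¹ Rₙ`
(`ReesAlgebraData`, `WeightedResolutionDatum.lean`), an affine open `U ⊆ Y`, the affine open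
`UK = pr⁻¹(U)` and an ideal sheaf `X` on `Y`, there is a morphism `prB : B₊(UK) → B₊(U)` of the
cobordant blow-ups of the charts (Włodarczyk, arXiv:2203.03090, Def. 2.3.5) making
`B₊(UK) → Spec K` the base change of `B₊(U) → Spec k`, commuting with the maps to `Y`, pulling the
strict transform of `X ∩ U` (3.3.12–3.3.13) back to that of `pr⁻¹X ∩ UK`, matching the
exceptional divisors `V(t⁻¹)`, and surjective.

How (namespace `CobordantPlusBaseChange`). Notation: `A = Γ(Y, U)`, `A' = Γ(YK, UK)`,
`ρ = pr♯ : A → A'`, `I = R.chartIdeals U`, `I' = RK.chartIdeals UK`, `S = extReesAlgebra I`,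
`S' = extReesAlgebra I'`, `B = Spec S ⊇ B₊ = B ∖ Vert(B)`, `ψ : S → S'` the map given by `H`.

* `isPushout_of_existsUnique` — a square of rings with the universal property of the pushout (in
  the `∃!` form of `H`) is a pushout in `CommRingCat`; `isPullback_specMap_π` — hence
  `Spec ψ : B' → B` is the base change of `Spec ρ` (Mathlib `isPullback_SpecMap_of_isPushout`);
* `isPullback_resLE_plusOpens` — `B'₊ → B₊` is the base change of `Spec ψ` along `B₊ ⊆ B` as
  soon as `(Spec ψ)⁻¹ B₊ = B'₊`; `exists_plus_baseChange` — affine assembly: inverse images along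
  `Spec ψ` of the ideal sheaves of ideals of `S`, of `B₊` (vertex ideals correspond), of `V(t⁻¹)`,
  of strict transforms (the computations of the tree's `…CobordantPlusBasicOpen.lean`, redone as
  local facts), restriction to the plus opens and pasting;
* `isPullback_SpecMap_app_fromSpec` — the square `Spec A' → Spec A` over `Spec K → Spec k` is
  cartesian: sections of a fibre product over affine opens form a pushout of rings (Mathlib
  `isIso_pushoutSection_of_isAffineOpen`) and `Spec Γ(Spec k, ⊤) ≅ Spec k`;
* the stub: `pr` is affine and flat (base change of the faithfully flat `Spec K → Spec k`), so
  `ρ` is flat and `I'ₙ = Iₙ A'`, `(pr⁻¹X)(UK) = X(U) A'` (`ideal_comap_preimage_of_isAffineHom`);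
  apply `H`, assemble, paste the two cartesian squares; surjectivity is inherited from
  `Spec K → Spec k` by base change.

## Sources

* J. Włodarczyk, *Functorial resolution by torus actions*, arXiv:2203.03090, Def. 2.3.5,
  3.3.12–3.3.13, App. Def. 5.1.1. [Wlodarczyk2022]
-/

set_option linter.dupNamespace false -- mandated namespace of this single-conjunct summit

namespace Summit.ResolutionOfSingularities.ResolutionOfSingularities.Theorems

open CategoryTheory CategoryTheory.Limits AlgebraicGeometry TopologicalSpace
open Literature.AlgebraicGeometry.Resolution
open scoped LaurentPolynomial

namespace CobordantPlusBaseChange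

universe u

/-- A commutative square of commutative rings `ψ ∘ i = i' ∘ ρ` with the universal property of
the pushout — every pair `α : A' → Q`, `β : S → Q` with `α ∘ ρ = β ∘ i` factors uniquely through
`S'` — is a pushout square in `CommRingCat`. [folklore] -/
theorem isPushout_of_existsUnique {A A' S S' : Type u} [CommRing A] [CommRing A'] [CommRing S]
    [CommRing S'] (ρ : A →+* A') (i : A →+* S) (i' : A' →+* S') (ψ : S →+* S')
    (hcomm : ψ.comp i = i'.comp ρ)
    (huniv : ∀ (Q : Type u) [CommRing Q] (α : A' →+* Q) (β : S →+* Q), α.comp ρ = β.comp i →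
      ∃! γ : S' →+* Q, γ.comp i' = α ∧ γ.comp ψ = β) :
    IsPushout (CommRingCat.ofHom ρ) (CommRingCat.ofHom i) (CommRingCat.ofHom i')
      (CommRingCat.ofHom ψ) := by
  have w : CommRingCat.ofHom ρ ≫ CommRingCat.ofHom i' =
      CommRingCat.ofHom i ≫ CommRingCat.ofHom ψ := by
    rw [← CommRingCat.ofHom_comp, ← CommRingCat.ofHom_comp, hcomm]
  -- the condition of a cocone, at the level of ring maps
  have hcond : ∀ s : PushoutCocone (CommRingCat.ofHom ρ) (CommRingCat.ofHom i),
      s.inl.hom.comp ρ = s.inr.hom.comp i := fun s =>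
    congrArg CommRingCat.Hom.hom s.condition
  refine IsPushout.of_isColimit' ⟨w⟩ (PushoutCocone.IsColimit.mk w
    (fun s => CommRingCat.ofHom (huniv s.pt s.inl.hom s.inr.hom (hcond s)).exists.choose)
    (fun s => ?_) (fun s => ?_) (fun s m hm₁ hm₂ => ?_))
  · exact CommRingCat.hom_ext (huniv s.pt s.inl.hom s.inr.hom (hcond s)).exists.choose_spec.1
  · exact CommRingCat.hom_ext (huniv s.pt s.inl.hom s.inr.hom (hcond s)).exists.choose_spec.2
  · exact CommRingCat.hom_ext ((huniv s.pt s.inl.hom s.inr.hom (hcond s)).unique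
      ⟨congrArg CommRingCat.Hom.hom hm₁, congrArg CommRingCat.Hom.hom hm₂⟩
      (huniv s.pt s.inl.hom s.inr.hom (hcond s)).exists.choose_spec)

/-- For a homomorphism of fields `φ : k → K`, `Spec K → Spec k` is flat and surjective (`K` is a
non-zero free, hence faithfully flat, `k`-module). [folklore] -/
theorem flat_and_surjective_SpecMap_of_field {k K : Type u} [Field k] [Field K] (φ : k →+* K) :
    Flat (Spec.map (CommRingCat.ofHom φ)) ∧ Surjective (Spec.map (CommRingCat.ofHom φ)) := by
  rw [flat_and_surjective_SpecMap_iff, CommRingCat.hom_ofHom]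
  letI := φ.toAlgebra
  exact (inferInstance : Module.FaithfullyFlat k K)

/-! ## `Spec ψ : B' → B` over `Spec ρ` and its restriction to the plus opens

Throughout, `φ : B' → B` is `Spec ψ` *typed over the full cobordant blow-ups*
(`affineCobordantBlowup I = Spec S` is a definition): a variable `φ` with the hypothesis
`hφ : φ = Spec.map (CommRingCat.ofHom ψ)` (the device of the tree's
`…CobordantPlusBasicOpen.lean`). -/

section Affine

variable {A A' : Type u} [CommRing A] [CommRing A'] (I : ℕ → Ideal A) (I' : ℕ → Ideal A')
  (ψ : extReesAlgebra I →+* extReesAlgebra I')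
  (φ : affineCobordantBlowup I' ⟶ affineCobordantBlowup I)
  (hφ : φ = Spec.map (CommRingCat.ofHom ψ))

include hφ in
/-- **`Spec` turns the pushout `S' = S ⊗_A A'` into a cartesian square**: if `ψ` extends `ρ` and
the square `(ρ, ψ)` has the universal property of the pushout of rings, then
`Spec ψ : B' → B` is the base change of `Spec ρ : Spec A' → Spec A` along `B → Spec A`.
[folklore] -/
theorem isPullback_specMap_π (ρ : A →+* A')
    (hψC : ψ.comp (algebraMap A (extReesAlgebra I)) =
      (algebraMap A' (extReesAlgebra I')).comp ρ)
    (huniv : ∀ (Q : Type u) [CommRing Q] (α : A' →+* Q) (β : extReesAlgebra I →+* Q),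
      α.comp ρ = β.comp (algebraMap A (extReesAlgebra I)) →
      ∃! γ : extReesAlgebra I' →+* Q,
        γ.comp (algebraMap A' (extReesAlgebra I')) = α ∧ γ.comp ψ = β) :
    IsPullback φ (affineCobordantBlowup.π I') (affineCobordantBlowup.π I)
      (Spec.map (CommRingCat.ofHom ρ)) := by
  subst hφ
  unfold affineCobordantBlowup.π affineCobordantBlowup
  exact (isPullback_SpecMap_of_isPushout _ _ _ _
    (isPushout_of_existsUnique ρ (algebraMap A (extReesAlgebra I))
      (algebraMap A' (extReesAlgebra I')) ψ hψC huniv)).flip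

/-- **Restriction to the plus opens is a base change**: when `φ⁻¹ B₊ = B'₊`, the restriction
`B'₊ → B₊` of `φ` is the base change of `φ` along the open immersion `B₊ ⊆ B`. [folklore] -/
theorem isPullback_resLE_plusOpens
    (hpre : φ ⁻¹ᵁ affineCobordantBlowup.plusOpens I = affineCobordantBlowup.plusOpens I') :
    IsPullback
      (φ.resLE (affineCobordantBlowup.plusOpens I) (affineCobordantBlowup.plusOpens I') hpre.ge)
      (affineCobordantBlowup.plusOpens I').ι (affineCobordantBlowup.plusOpens I).ι φ :=
  IsOpenImmersion.isPullback _ _ _ _ (Scheme.Hom.resLE_comp_ι φ hpre.ge).symm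
    (by simpa only [Scheme.Opens.opensRange_ι] using hpre)

/-- **Affine assembly.** Let `ψ : S = A[t⁻¹, Iₙ tⁿ] → S' = A'[t⁻¹, I'ₙ tⁿ]` extend `ρ : A → A'`,
fix `t⁻¹`, map the vertex ideal onto the vertex ideal and `σˢ(𝔞)` onto `σˢ(𝔞')`, and let
`(ρ, ψ)` be a pushout of rings. Then the restriction `j : B'₊ → B₊` of `Spec ψ` is the base change
of `Spec ρ` along `σ₊ : B₊ → Spec A`, pulls the strict transform of `V(𝔞)` back to that of
`V(𝔞')`, and matches the exceptional divisors (Włodarczyk, Def. 2.3.5 and 3.3.12–3.3.13: the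
cobordant blow-up and strict transforms commute with flat base change).
[cite: Wlodarczyk2022, Def. 2.3.5] -/
theorem exists_plus_baseChange (ρ : A →+* A')
    (hψC : ψ.comp (algebraMap A (extReesAlgebra I)) =
      (algebraMap A' (extReesAlgebra I')).comp ρ)
    (hs : ψ (extReesAlgebra.tInv I) = extReesAlgebra.tInv I')
    (hvert : (extReesAlgebra.vertexIdeal I).map ψ = extReesAlgebra.vertexIdeal I')
    {𝔞 : Ideal A} {𝔞' : Ideal A'}
    (hst : (extReesAlgebra.strictTransform I 𝔞).map ψ = extReesAlgebra.strictTransform I' 𝔞')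
    (huniv : ∀ (Q : Type u) [CommRing Q] (α : A' →+* Q) (β : extReesAlgebra I →+* Q),
      α.comp ρ = β.comp (algebraMap A (extReesAlgebra I)) →
      ∃! γ : extReesAlgebra I' →+* Q,
        γ.comp (algebraMap A' (extReesAlgebra I')) = α ∧ γ.comp ψ = β) :
    ∃ j : (affineCobordantBlowup.plusOpens I' : Scheme.{u}) ⟶ affineCobordantBlowup.plusOpens I,
      IsPullback j (affineCobordantBlowup.plusπ I') (affineCobordantBlowup.plusπ I)
        (Spec.map (CommRingCat.ofHom ρ)) ∧
      (affineCobordantBlowup.strictTransformPlus I 𝔞).comap j =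
        affineCobordantBlowup.strictTransformPlus I' 𝔞' ∧
      (∀ b' : affineCobordantBlowup.plusOpens I',
        (affineCobordantBlowup.plusOpens I).ι (j b') ∈
            ((affineCobordantBlowup.exceptional I).support : Set (affineCobordantBlowup I)) ↔
          (affineCobordantBlowup.plusOpens I').ι b' ∈
            ((affineCobordantBlowup.exceptional I').support : Set (affineCobordantBlowup I'))) := by
  -- `φ = Spec ψ`, typed over the full cobordant blow-ups `B' = Spec S'`, `B = Spec S`
  obtain ⟨φ, hφ⟩ : ∃ φ : affineCobordantBlowup I' ⟶ affineCobordantBlowup I,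
      φ = Spec.map (CommRingCat.ofHom ψ) := ⟨_, rfl⟩
  -- the computations along `φ` of the tree's `…CobordantPlusBasicOpen.lean` (stated there for a
  -- localisation `ψ`; the module cannot be imported here), as local facts:
  -- points of `B'` go to their contractions,
  have hpt : ∀ x : affineCobordantBlowup I', (φ x).asIdeal = x.asIdeal.comap ψ := by
    intro x
    subst hφ
    rfl
  -- the inverse image of the ideal sheaf of `J ≤ S` is the ideal sheaf of `J S'`,
  have hcomap : ∀ J : Ideal (extReesAlgebra I), (affineCobordantBlowup.idealSheaf I J).comap φ =
      affineCobordantBlowup.idealSheaf I' (J.map ψ) := by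
    intro J
    subst hφ
    unfold affineCobordantBlowup.idealSheaf affineCobordantBlowup
    exact comap_ofIdealTop_SpecMap ψ J
  -- and `φ⁻¹ B₊ = B'₊` (the vertex ideals correspond)
  have hpre : φ ⁻¹ᵁ affineCobordantBlowup.plusOpens I = affineCobordantBlowup.plusOpens I' := by
    ext x
    change φ x ∈ affineCobordantBlowup.plusOpens I ↔ x ∈ affineCobordantBlowup.plusOpens I'
    rw [OffExceptional.mem_plusOpens_iff, OffExceptional.mem_plusOpens_iff, ← hvert,
      Ideal.map_le_iff_le_comap, hpt]
  refine ⟨φ.resLE _ _ hpre.ge, (isPullback_resLE_plusOpens I I' φ hpre).paste_vert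
    (isPullback_specMap_π I I' ψ φ hφ ρ hψC huniv), ?_, fun b' => ?_⟩
  · -- strict transforms (Włodarczyk 3.3.12–3.3.13)
    unfold affineCobordantBlowup.strictTransformPlus affineCobordantBlowup.plus
    rw [← Scheme.IdealSheafData.comap_comp, Scheme.Hom.resLE_comp_ι,
      Scheme.IdealSheafData.comap_comp, hcomap, hst]
  · -- exceptional divisors: `ψ t⁻¹ = t⁻¹`
    rw [Scheme.Opens.ι_apply, Scheme.Opens.ι_apply, Scheme.Hom.coe_resLE_apply, ← not_iff_not]
    change φ _ ∉ (affineCobordantBlowup.exceptional I).support ↔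
      _ ∉ (affineCobordantBlowup.exceptional I').support
    rw [OffExceptional.not_mem_support_exceptional_iff,
      OffExceptional.not_mem_support_exceptional_iff, ← hs, hpt, Ideal.mem_comap]

end Affine

/-- **The affine pieces of a base change form a cartesian square of affine schemes.** For a
cartesian square `pr : YK → Y`, `fK : YK → Spec K`, `f : Y → Spec k`, `Spec φ : Spec K → Spec k`
and an affine open `U ⊆ Y` with `pr⁻¹U` affine, the square `Spec pr♯ : Spec Γ(YK, pr⁻¹U) →
Spec Γ(Y, U)`, `Spec Γ(YK, pr⁻¹U) → YK → Spec K`, `Spec Γ(Y, U) → Y → Spec k`, `Spec φ` is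
cartesian: the sections over affine opens of a fibre product are the pushout of the sections
(Mathlib `isIso_pushoutSection_of_isAffineOpen`), and `Spec` turns pushouts of rings into
pullbacks. [folklore] -/
theorem isPullback_SpecMap_app_fromSpec {k K : Type u} [CommRing k] [CommRing K] (φ : k →+* K)
    {Y YK : Scheme.{u}} {f : Y ⟶ Spec (.of k)} {fK : YK ⟶ Spec (.of K)} {pr : YK ⟶ Y}
    (hpb : IsPullback pr fK f (Spec.map (CommRingCat.ofHom φ))) (U : Y.affineOpens)
    (hV : IsAffineOpen (pr ⁻¹ᵁ (U : Y.Opens))) :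
    IsPullback (Spec.map (pr.app U)) (hV.fromSpec ≫ fK) (U.2.fromSpec ≫ f)
      (Spec.map (CommRingCat.ofHom φ)) := by
  have hUY : pr ⁻¹ᵁ (U : Y.Opens) = pr ⁻¹ᵁ (U : Y.Opens) ⊓ fK ⁻¹ᵁ ⊤ := by simp
  -- the sections square is a pushout of rings
  have hpush := (isIso_pushoutSection_iff hpb
    (le_top (a := (⊤ : (Spec (CommRingCat.of K)).Opens))) (le_top (a := (U : Y.Opens))) hUY).mp
    (isIso_pushoutSection_of_isAffineOpen hpb _ _ hUY (isAffineOpen_top _) (isAffineOpen_top _)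
      U.2)
  have sq1 := isPullback_SpecMap_of_isPushout _ _ _ _ hpush
  -- `Spec Γ(Spec k, ⊤) ≅ Spec k`, `Spec Γ(Spec K, ⊤) ≅ Spec K`
  haveI : IsIso (isAffineOpen_top (Spec (CommRingCat.of K))).fromSpec := by
    rw [IsAffineOpen.fromSpec_top]
    infer_instance
  haveI : IsIso (isAffineOpen_top (Spec (CommRingCat.of k))).fromSpec := by
    rw [IsAffineOpen.fromSpec_top]
    infer_instance
  have sq2 : IsPullback (Spec.map ((Spec.map (CommRingCat.ofHom φ)).appLE ⊤ ⊤ le_top))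
      (isAffineOpen_top (Spec (CommRingCat.of K))).fromSpec
      (isAffineOpen_top (Spec (CommRingCat.of k))).fromSpec (Spec.map (CommRingCat.ofHom φ)) :=
    IsPullback.of_vert_isIso ⟨IsAffineOpen.SpecMap_appLE_fromSpec _ _ _ _⟩
  have big := sq1.paste_vert sq2
  rw [IsAffineOpen.SpecMap_appLE_fromSpec fK (isAffineOpen_top _) hV,
    IsAffineOpen.SpecMap_appLE_fromSpec f (isAffineOpen_top _) U.2, Scheme.Hom.appLE_eq_app] at big
  exact big

end CobordantPlusBaseChange

/-! ## The stub -/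

/-- **Cobordant blow-ups of affine charts commute with extension of the ground field** (stub
`stub_cobordantPlus_baseChange` of line `support-first-weights-second`, registered signature;
conditional on the ring statement `H` = stub `stub_extReesAlgebra_baseChange`: the extended Rees
algebra commutes with flat base change, compatibly with `t⁻¹`, the vertex ideal and strict
transforms, with the universal property of the pushout). For a cartesian square
`pr : YK = Y ×_k K → Y` over a field homomorphism `φ : k → K`, Rees algebras `R` on `Y` and `RK`
on `YK` with `RKₙ = pr⁻¹ Rₙ`, an affine open `U` and the affine open `UK = pr⁻¹(U)`: there is a
morphism `prB : B₊(UK) → B₊(U)` making `B₊(UK) → Spec K` the base change of `B₊(U) → Spec k`,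
compatible with the projections to `Y`, along which the strict transform of `X` pulls back to the
strict transform of `pr⁻¹ X`, which matches the exceptional divisors, and which is surjective
(`Γ(UK) = Γ(U) ⊗_k K` is flat over `Γ(U)`, `Γ(B(UK)) = Γ(B(U)) ⊗_{Γ(U)} Γ(UK)` by `H`, `Spec`
turns pushouts into pullbacks, restrict to the plus opens; Włodarczyk, arXiv:2203.03090,
Def. 2.3.5 and 3.3.12–3.3.13). [cite: Wlodarczyk2022, Def. 2.3.5] -/
theorem stub_cobordantPlus_baseChange :
    (∀ {A A' : Type} [CommRing A] [CommRing A'] [Algebra A A'] [Module.Flat A A']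
      (I : ℕ → Ideal A) (I' : ℕ → Ideal A'), (∀ n, I' n = (I n).map (algebraMap A A')) →
      ∃ ψ : extReesAlgebra I →+* extReesAlgebra I',
        (∀ x : extReesAlgebra I, ((ψ x : extReesAlgebra I') : A'[T;T⁻¹]) =
            AddMonoidAlgebra.mapRingHom ℤ (algebraMap A A') (x : A[T;T⁻¹])) ∧
        ψ.comp (algebraMap A (extReesAlgebra I)) =
          (algebraMap A' (extReesAlgebra I')).comp (algebraMap A A') ∧
        ψ (extReesAlgebra.tInv I) = extReesAlgebra.tInv I' ∧
        (extReesAlgebra.vertexIdeal I).map ψ = extReesAlgebra.vertexIdeal I' ∧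
        (∀ 𝔞 : Ideal A, (extReesAlgebra.strictTransform I 𝔞).map ψ =
          extReesAlgebra.strictTransform I' (𝔞.map (algebraMap A A'))) ∧
        (∀ (Q : Type) [CommRing Q] (α : A' →+* Q) (β : extReesAlgebra I →+* Q),
          α.comp (algebraMap A A') = β.comp (algebraMap A (extReesAlgebra I)) →
          ∃! γ : extReesAlgebra I' →+* Q,
            γ.comp (algebraMap A' (extReesAlgebra I')) = α ∧ γ.comp ψ = β)) →
    ∀ ⦃k : Type⦄ [Field k] ⦃K : Type⦄ [Field K] (φ : k →+* K) ⦃Y YK : Scheme.{0}⦄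
      (f : Y ⟶ Spec (.of k)) (fK : YK ⟶ Spec (.of K)) (pr : YK ⟶ Y),
      IsPullback pr fK f (Spec.map (CommRingCat.ofHom φ)) →
      ∀ (R : ReesAlgebraData Y) (RK : ReesAlgebraData YK),
        (∀ n, RK.piece n = (R.piece n).comap pr) →
      ∀ (U : Y.affineOpens) (UK : YK.affineOpens), (UK : YK.Opens) = pr ⁻¹ᵁ (U : Y.Opens) →
      ∀ (X : Y.IdealSheafData),
        ∃ prB : RK.cobordantPlus UK ⟶ R.cobordantPlus U,
          IsPullback prB (RK.cobordantPlusι UK ≫ fK) (R.cobordantPlusι U ≫ f)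
            (Spec.map (CommRingCat.ofHom φ)) ∧
          prB ≫ R.cobordantPlusι U = RK.cobordantPlusι UK ≫ pr ∧
          (R.cobordantStrictTransform U X).comap prB = RK.cobordantStrictTransform UK (X.comap pr) ∧
          (∀ b' : RK.cobordantPlus UK,
            (affineCobordantBlowup.plusOpens (R.chartIdeals U)).ι (prB b') ∈
                ((affineCobordantBlowup.exceptional (R.chartIdeals U)).support :
                  Set (affineCobordantBlowup (R.chartIdeals U))) ↔
              (affineCobordantBlowup.plusOpens (RK.chartIdeals UK)).ι b' ∈
                ((affineCobordantBlowup.exceptional (RK.chartIdeals UK)).support :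
                  Set (affineCobordantBlowup (RK.chartIdeals UK)))) ∧
          Function.Surjective (fun b' : RK.cobordantPlus UK => prB b') := by
  intro H k _ K _ φ Y YK f fK pr hpb R RK hRK U UK hUK X
  obtain ⟨V, hV⟩ := UK
  change V = pr ⁻¹ᵁ (U : Y.Opens) at hUK
  subst hUK
  -- `pr` is affine and flat: a base change of the faithfully flat `Spec K → Spec k`
  haveI : IsAffineHom pr := MorphismProperty.of_isPullback hpb.flip inferInstance
  haveI : Flat pr := MorphismProperty.of_isPullback hpb.flip
    (CobordantPlusBaseChange.flat_and_surjective_SpecMap_of_field φ).1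
  -- the rings `A = Γ(Y, U)`, `A' = Γ(YK, pr⁻¹U)` and the flat `ρ = pr♯ : A → A'`
  letI alg : Algebra Γ(Y, U) Γ(YK, pr ⁻¹ᵁ (U : Y.Opens)) := (pr.app U).hom.toAlgebra
  haveI : Module.Flat Γ(Y, U) Γ(YK, pr ⁻¹ᵁ (U : Y.Opens)) := by
    have h := pr.flat_appLE U.2 hV le_rfl
    rw [Scheme.Hom.appLE_eq_app] at h
    exact h
  -- the pieces of `RK` and `pr⁻¹X` over `pr⁻¹U` are extended from `U` (`pr` is affine)
  have hI' : ∀ n, RK.chartIdeals ⟨pr ⁻¹ᵁ (U : Y.Opens), hV⟩ n =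
      (R.chartIdeals U n).map (algebraMap Γ(Y, U) Γ(YK, pr ⁻¹ᵁ (U : Y.Opens))) := fun n => by
    rw [ReesAlgebraData.chartIdeals_apply, ReesAlgebraData.chartIdeals_apply, hRK n]
    exact ideal_comap_preimage_of_isAffineHom (R.piece n) pr U
  have hXU : (X.comap pr).ideal ⟨pr ⁻¹ᵁ (U : Y.Opens), hV⟩ =
      (X.ideal U).map (algebraMap Γ(Y, U) Γ(YK, pr ⁻¹ᵁ (U : Y.Opens))) :=
    ideal_comap_preimage_of_isAffineHom X pr U
  -- the base change `ψ : S → S'` of the extended Rees algebras (hypothesis `H`)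
  obtain ⟨ψ, -, hcomp, hs, hvert, hstrict, huniv⟩ :=
    H (R.chartIdeals U) (RK.chartIdeals ⟨pr ⁻¹ᵁ (U : Y.Opens), hV⟩) hI'
  -- affine assembly: `prB = (Spec ψ)|B₊`, a base change of `Spec ρ`
  obtain ⟨j, hsq, hst, hexc⟩ := CobordantPlusBaseChange.exists_plus_baseChange
    (R.chartIdeals U) (RK.chartIdeals ⟨pr ⁻¹ᵁ (U : Y.Opens), hV⟩) ψ (pr.app U).hom hcomp hs hvert
    (𝔞 := X.ideal U) (𝔞' := (X.comap pr).ideal ⟨pr ⁻¹ᵁ (U : Y.Opens), hV⟩)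
    (by rw [hXU]; exact hstrict (X.ideal U)) huniv
  rw [CommRingCat.ofHom_hom] at hsq
  -- the sections square `Spec A' → Spec A` over `Spec K → Spec k`
  have hc := CobordantPlusBaseChange.isPullback_SpecMap_app_fromSpec φ hpb U hV
  have hfs : Spec.map (pr.app U) ≫ U.2.fromSpec = hV.fromSpec ≫ pr := by
    rw [Scheme.Hom.app_eq_appLE]
    exact IsAffineOpen.SpecMap_appLE_fromSpec pr U.2 hV le_rfl
  refine ⟨j, ?_, ?_, hst, hexc, ?_⟩
  · -- the square over `Spec K → Spec k`: paste
    have big := hsq.paste_vert hc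
    rw [ReesAlgebraData.cobordantPlusι, ReesAlgebraData.cobordantPlusι, Category.assoc,
      Category.assoc]
    exact big
  · -- over `Y` (a chain of equations by terms: the objects `B₊ = ↑(plusOpens I)` and
    -- `R.cobordantPlus U` agree only up to unfolding)
    have e1 : j ≫ R.cobordantPlusι U =
        (j ≫ affineCobordantBlowup.plusπ (R.chartIdeals U)) ≫ U.2.fromSpec :=
      (Category.assoc _ _ _).symm
    have e2 : (j ≫ affineCobordantBlowup.plusπ (R.chartIdeals U)) ≫ U.2.fromSpec =
        (affineCobordantBlowup.plusπ (RK.chartIdeals ⟨pr ⁻¹ᵁ (U : Y.Opens), hV⟩) ≫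
          Spec.map (pr.app U)) ≫ U.2.fromSpec :=
      hsq.w =≫ U.2.fromSpec
    have e3 : (affineCobordantBlowup.plusπ (RK.chartIdeals ⟨pr ⁻¹ᵁ (U : Y.Opens), hV⟩) ≫
          Spec.map (pr.app U)) ≫ U.2.fromSpec =
        RK.cobordantPlusι ⟨pr ⁻¹ᵁ (U : Y.Opens), hV⟩ ≫ pr :=
      (Category.assoc _ _ _).trans
        ((affineCobordantBlowup.plusπ _ ≫= hfs).trans (Category.assoc _ _ _).symm)
    exact e1.trans (e2.trans e3)
  · -- surjective: a base change of the surjective `Spec K → Spec k`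
    haveI : Surjective (Spec.map (CommRingCat.ofHom φ)) :=
      (CobordantPlusBaseChange.flat_and_surjective_SpecMap_of_field φ).2
    haveI : Surjective (Spec.map (pr.app U)) := MorphismProperty.of_isPullback hc.flip ‹_›
    haveI : Surjective j := MorphismProperty.of_isPullback hsq.flip ‹_›
    exact j.surjective

end Summit.ResolutionOfSingularities.ResolutionOfSingularities.Theorems
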